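import Summits.KontsevichZagierPeriods.KontsevichZagierPeriods.Theorems.SoloInformedAlgConeCases
import Summits.KontsevichZagierPeriods.KontsevichZagierPeriods.Theorems.SoloInformedAnDrop
import HarnessLib

/-!
# The DEN-calculus over `K`: every polynomial has the vertex-germ property

Solo programme `solo-KontsevichZagierPeriods-informed`, session s107, step (x-r) of the general
two-dimensional algorithm — **THEOREM VG** `soloInformed_vertexGermOK`: for a subfield `K ⊂ ℝ` of
real algebraic numbers that contains every real root of its polynomials, every
`F ∈ K[x₀, x₁]` has the vertex-germ property: `∫_{(0,1)²} xᵉ/(U·F) ∈` DEN whenever `U` is a unit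
on the closed square and `F` has an isolated zero at the origin.

The proof is a well-founded induction on the **termination measure**
`μ(F) = (mult₀ F, ν) ∈ ℕ ×ₗ (ℕ∞ ×ₗ ℕ∞)`: the mixed-cone step lowers the multiplicity of every
child; the pure-cone step keeps it at most equal and, when equal, the drop lemma lowers `ν`; the
swapped pure-cone case has the same measure as its swap.

References: J. Kollár, *Lectures on Resolution of Singularities* (2007), §1.10;
M. Kontsevich, D. Zagier, *Periods* (2001), §1.2.
-/

noncomputable section

open scoped BigOperators
open Polynomial

namespace Summit.KontsevichZagierPeriods.KontsevichZagierPeriods.Theorems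

variable {K : Type*} [Field K] [Algebra K ℝ]

/-! ### Multiplicity, top coefficients and the measure -/

omit [Algebra K ℝ] in
/-- The swap preserves the multiplicity. [this work] -/
theorem soloInformed_multK_swapK (F : MvPolynomial (Fin 2) K) :
    soloInformedMultK (soloInformedSwapK F) = soloInformedMultK F := by
  by_cases hF : F = 0
  · rw [hF, map_zero]
  obtain ⟨a, ha, hdeg⟩ := soloInformed_exists_deg_eq_multK hF
  exact soloInformed_multK_eq_of_le_deg
    (soloInformed_le_deg_swapK (soloInformed_le_deg_of_multK_eq rfl))
    (soloInformed_swapK_support_witness ha)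
    (by rw [(soloInformed_single_add_single_apply _ _).1,
      (soloInformed_single_add_single_apply _ _).2, add_comm, hdeg])

omit [Algebra K ℝ] in
/-- The top coefficient of the cone polynomial is the pure `x₁^m` coefficient. [this work] -/
theorem soloInformed_coeff_conePolyK_self (F : MvPolynomial (Fin 2) K) {m : ℕ}
    (hm : ∀ a ∈ F.support, m ≤ a 0 + a 1) :
    (soloInformedConePolyK F m).coeff m = MvPolynomial.coeff (Finsupp.single 1 m) F := by
  rw [soloInformed_coeff_conePolyK F hm, if_pos le_rfl, Nat.sub_self, Finsupp.single_zero, zero_add]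

/-- The measure when the pure `x₁^m` coefficient is non-zero. [this work] -/
theorem soloInformed_muK_eq_of_topCoeff_ne {F : MvPolynomial (Fin 2) K}
    (h : soloInformedTopCoeffK F ≠ 0) :
    soloInformedMuK F = toLex (soloInformedMultK F, soloInformedNuK F) := by
  unfold soloInformedMuK
  rw [if_pos h]

/-- The measure when only the pure `x₀^m` coefficient is non-zero. [this work] -/
theorem soloInformed_muK_eq_of_topCoeff_swapK_ne {F : MvPolynomial (Fin 2) K}
    (h0 : soloInformedTopCoeffK F = 0) (h1 : soloInformedTopCoeffK (soloInformedSwapK F) ≠ 0) :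
    soloInformedMuK F = toLex (soloInformedMultK F, soloInformedNuK (soloInformedSwapK F)) := by
  unfold soloInformedMuK
  rw [if_neg (not_not.2 h0), if_pos h1]

/-- A smaller multiplicity gives a smaller measure. [this work] -/
theorem soloInformed_muK_lt_of_multK_lt {G F : MvPolynomial (Fin 2) K}
    (h : soloInformedMultK G < soloInformedMultK F) : soloInformedMuK G < soloInformedMuK F := by
  unfold soloInformedMuK
  rw [Prod.Lex.toLex_lt_toLex]
  exact Or.inl h

/-! ### Reflecting a pure cone -/

omit [Algebra K ℝ] in
/-- The reflection of a pure power with non-zero root is a pure power: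
`reflect m (c (X − θ)^m) = c (−θ)^m (X − θ⁻¹)^m`. [this work] -/
theorem soloInformed_reflect_pureCone (c : K) {θ : K} (hθ : θ ≠ 0) (m : ℕ) :
    (C c * (X - C θ) ^ m).reflect m = C (c * (-θ) ^ m) * (X - C θ⁻¹) ^ m := by
  ext i
  rw [Polynomial.coeff_reflect, Polynomial.coeff_C_mul, Polynomial.coeff_C_mul, sub_eq_add_neg,
    sub_eq_add_neg, ← map_neg C, ← map_neg C, Polynomial.coeff_X_add_C_pow,
    Polynomial.coeff_X_add_C_pow]
  by_cases hi : i ≤ m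
  · rw [Polynomial.revAt_le hi, Nat.sub_sub_self hi, Nat.choose_symm hi]
    have hsplit : (-θ) ^ m = (-θ) ^ i * (-θ) ^ (m - i) := by rw [← pow_add, Nat.add_sub_cancel' hi]
    rw [hsplit, neg_inv, inv_pow]
    have hpow : (-θ) ^ (m - i) ≠ 0 := pow_ne_zero _ (neg_ne_zero.2 hθ)
    field_simp
  · have hlt : m < i := not_le.1 hi
    rw [Nat.choose_eq_zero_of_lt hlt, Nat.cast_zero, mul_zero, mul_zero]
    unfold Polynomial.revAt
    simp only [Function.Embedding.coeFn_mk, if_neg hi]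
    rw [Nat.choose_eq_zero_of_lt hlt, Nat.cast_zero, mul_zero, mul_zero]

/-- **The swapped pure case has the measure of its swap.**  If `cone_F` is not a pure power with
non-negative root but `cone_{swap F} = c (X − θ)^m` (`c ≠ 0`, `θ ≥ 0`), then `θ = 0`, the pure
`x₁^m` coefficient of `F` vanishes, that of `swap F` does not, and `μ(F) = μ(swap F)`. [this work] -/
theorem soloInformed_muK_eq_muK_swapK {F : MvPolynomial (Fin 2) K} {k : ℕ}
    (hmult : soloInformedMultK F = k + 1)
    (h₁ : ∀ c t : K, c ≠ 0 → 0 ≤ algebraMap K ℝ t →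
      soloInformedConePolyK F (k + 1) ≠ C c * (X - C t) ^ (k + 1))
    {c θ : K} (hc : c ≠ 0) (hθ : 0 ≤ algebraMap K ℝ θ)
    (hcone : soloInformedConePolyK (soloInformedSwapK F) (k + 1) = C c * (X - C θ) ^ (k + 1)) :
    soloInformedMuK F = soloInformedMuK (soloInformedSwapK F) := by
  have hm := soloInformed_le_deg_of_multK_eq hmult
  have hm₂ := soloInformed_le_deg_swapK hm
  have hmult₂ : soloInformedMultK (soloInformedSwapK F) = k + 1 := by
    rw [soloInformed_multK_swapK, hmult]
  -- `cone_F` is the reflection of `cone_{swap F}`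
  have hrefl : soloInformedConePolyK F (k + 1) = (C c * (X - C θ) ^ (k + 1)).reflect (k + 1) := by
    rw [← hcone, ← soloInformed_conePolyK_swapK _ hm₂, soloInformed_swapK_swapK]
  -- `θ = 0`
  have hθ0 : θ = 0 := by
    by_contra hne
    refine h₁ (c * (-θ) ^ (k + 1)) θ⁻¹ (mul_ne_zero hc (pow_ne_zero _ (neg_ne_zero.2 hne))) ?_ ?_
    · rw [map_inv₀]; exact inv_nonneg.2 hθ
    · rw [hrefl, soloInformed_reflect_pureCone c hne]
  rw [hθ0, map_zero, sub_zero] at hcone hrefl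
  have htopF : soloInformedTopCoeffK F = 0 := by
    unfold soloInformedTopCoeffK
    rw [hmult, ← soloInformed_coeff_conePolyK_self F hm, hrefl, Polynomial.reflect_C_mul_X_pow,
      Polynomial.revAt_le le_rfl, Nat.sub_self, pow_zero, mul_one, Polynomial.coeff_C,
      if_neg (Nat.succ_ne_zero k)]
  have htopS : soloInformedTopCoeffK (soloInformedSwapK F) ≠ 0 := by
    unfold soloInformedTopCoeffK
    rw [hmult₂, ← soloInformed_coeff_conePolyK_self _ hm₂, hcone, Polynomial.coeff_C_mul_X_pow,
      if_pos rfl]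
    exact hc
  rw [soloInformed_muK_eq_of_topCoeff_swapK_ne htopF htopS, soloInformed_muK_eq_of_topCoeff_ne htopS,
    hmult, hmult₂]

/-! ### The pure-cone case with the induction hypothesis -/

/-- **The pure-cone case of the induction**: the children either have smaller multiplicity or,
by the drop lemma, smaller `ν`. [this work] -/
theorem soloInformed_vertexGermOK_pure_of_ih (hK : ∀ c : K, IsAlgebraic ℚ (algebraMap K ℝ c))
    {F : MvPolynomial (Fin 2) K} {k : ℕ} (hmult : soloInformedMultK F = k + 1) {c θ : K}
    (hc : c ≠ 0) (hθ : 0 ≤ algebraMap K ℝ θ)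
    (hcone : soloInformedConePolyK F (k + 1) = C c * (X - C θ) ^ (k + 1))
    (ih : ∀ G : MvPolynomial (Fin 2) K, soloInformedMuK G < soloInformedMuK F →
      SoloInformedVertexGermOK G) :
    SoloInformedVertexGermOK F := by
  intro e u U hu hU hF'
  have hm := soloInformed_le_deg_of_multK_eq hmult
  have htopF : soloInformedTopCoeffK F ≠ 0 := by
    unfold soloInformedTopCoeffK
    rw [hmult, ← soloInformed_coeff_conePolyK_self F hm, hcone,
      soloInformed_coeff_C_mul_X_sub_C_pow_self]
    exact hc
  refine soloInformed_vertexGermOK_of_pureCone hK hm hc hθ hcone (fun κ lam hκ hlam => ih _ ?_)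
    e u U hu hU hF'
  have hlamK : lam ≠ 0 := fun h => hlam (by rw [h, map_zero])
  rcases (soloInformed_multK_childK_le_of_pow hcone hc κ hlamK).lt_or_eq with hlt | heq
  · exact soloInformed_muK_lt_of_multK_lt (by rw [hmult]; exact hlt)
  · have hν := soloInformed_nuK_childK_lt hmult hc hθ hcone hF' hκ hlam heq
    have htopG : soloInformedTopCoeffK (soloInformedChildK F (k + 1) θ κ lam) ≠ 0 := by
      unfold soloInformedTopCoeffK
      rw [heq, soloInformed_coeff_childK_of_pow hcone κ lam]
      exact mul_ne_zero hc (pow_ne_zero _ hlamK)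
    rw [soloInformed_muK_eq_of_topCoeff_ne htopF, soloInformed_muK_eq_of_topCoeff_ne htopG, heq,
      hmult, Prod.Lex.toLex_lt_toLex]
    exact Or.inr ⟨rfl, hν⟩

/-! ### THEOREM VG -/

/-- The zero polynomial has the vertex-germ property (vacuously). [this work] -/
theorem soloInformed_vertexGermOK_zero : SoloInformedVertexGermOK (0 : MvPolynomial (Fin 2) K) := by
  intro e u U _ _ hF
  exfalso
  refine hF (fun _ => 1) (fun _ => ⟨zero_le_one, le_rfl⟩) (fun h => one_ne_zero (congr_fun h 0)) ?_
  rw [map_zero]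

/-- **THEOREM VG.**  Over a field `K` of real algebraic numbers containing the real roots of its
polynomials, every `F ∈ K[x₀, x₁]` has the vertex-germ property. [this work] -/
theorem soloInformed_vertexGermOK (hK : ∀ c : K, IsAlgebraic ℚ (algebraMap K ℝ c))
    (hKrc : SoloInformedRealRootClosed K) (F : MvPolynomial (Fin 2) K) :
    SoloInformedVertexGermOK F := by
  suffices h : ∀ μ : ℕ ×ₗ (ℕ∞ ×ₗ ℕ∞), ∀ F : MvPolynomial (Fin 2) K, soloInformedMuK F = μ →
      SoloInformedVertexGermOK F from h _ F rfl
  intro μ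
  induction μ using WellFoundedLT.induction with
  | ind μ ihμ =>
    intro F hμ
    have ih : ∀ G : MvPolynomial (Fin 2) K, soloInformedMuK G < soloInformedMuK F →
        SoloInformedVertexGermOK G := fun G hG => ihμ _ (hμ ▸ hG) G rfl
    classical
    by_cases hF0 : F = 0
    · rw [hF0]; exact soloInformed_vertexGermOK_zero
    rcases Nat.eq_zero_or_eq_succ_pred (soloInformedMultK F) with hzero | hsucc
    · exact soloInformed_vertexGermOK_of_apply_zero_ne hK
        (soloInformed_aevalK_zero_ne_of_multK hF0 hzero)
    set k := (soloInformedMultK F).pred with hk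
    have hmult : soloInformedMultK F = k + 1 := hsucc
    have hm := soloInformed_le_deg_of_multK_eq hmult
    obtain ⟨a₀, ha₀, hdeg⟩ := soloInformed_exists_deg_eq_multK hF0
    rw [hmult] at hdeg
    by_cases h₁ : ∃ c t : K, c ≠ 0 ∧ 0 ≤ algebraMap K ℝ t ∧
        soloInformedConePolyK F (k + 1) = C c * (X - C t) ^ (k + 1)
    · obtain ⟨c, t, hc, ht, hcone⟩ := h₁
      exact soloInformed_vertexGermOK_pure_of_ih hK hmult hc ht hcone ih
    push Not at h₁
    by_cases h₂ : ∃ c t : K, c ≠ 0 ∧ 0 ≤ algebraMap K ℝ t ∧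
        soloInformedConePolyK (soloInformedSwapK F) (k + 1) = C c * (X - C t) ^ (k + 1)
    · obtain ⟨c, t, hc, ht, hcone⟩ := h₂
      have hmult₂ : soloInformedMultK (soloInformedSwapK F) = k + 1 := by
        rw [soloInformed_multK_swapK, hmult]
      have hμeq := soloInformed_muK_eq_muK_swapK hmult h₁ hc ht hcone
      exact soloInformed_vertexGermOK_of_swapK hK
        (soloInformed_vertexGermOK_pure_of_ih hK hmult₂ hc ht hcone fun G hG => ih G (hμeq ▸ hG))
    push Not at h₂
    exact soloInformed_vertexGermOK_of_notPure hK hKrc hm ha₀ hdeg h₁ h₂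
      fun G hG => ih G (soloInformed_muK_lt_of_multK_lt (by rw [hmult]; exact hG))

end Summit.KontsevichZagierPeriods.KontsevichZagierPeriods.Theorems
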